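import Summits.ValiantsHypothesis.ValiantsHypothesis.Theorems.KPlusLogSqLawWeakLiftingTowerGraftTowerRowTwoSymDefs

/-!
# DATA of the GENERAL (non-symmetric) `m = 2` tower design with `4K − 7` sign-alternating dominant breakpoints on EVERY 2-tower:
# classes, slopes, convex costs (crossing times `4ᵏ`), valuations, signs; closed forms; strict slope monotonicity (tower); staircase bounds

Definitions-and-closed-forms file (objects only, no `Prop`-valued definition; proofs in `…TowerRowTwoGenChain`, `…TowerRowTwoGenIds`,
`…TowerRowTwoGen`).
Crux `TropicalB` (stmt-ValiantsHypothesis-19771) calibration, companion of the symmetric tower design `…TowerGraftTowerRowTwoSym`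
(`3K − 4`, crux `WeakLifting` 19561): the tree's exact GENERAL row `T(2, K) = 4K − 7` (`TwoRowFamily.tropRootLawAt_two_iff`, witnessed on the
near-arithmetic support `4K²·l + l²`) is ATTAINED ON EVERY 2-TOWER.  NO stub is claimed; nothing on `TropicalB` in its window, `WeakLifting`,
`MatrixDescartes` (18050) or `VP ≠ VNP`.  Seat: prover leafhand-val-kpluslogsqlaw-1 g3, `--supports stmt-ValiantsHypothesis-19771`.

THE DESIGN (2-tower `d`, `K ≥ 3`): identity terms along the STAIRCASE `(0,0),(0,1),(1,1),(1,2),…,(K−1,K−1)` of the class grid (entry `(0,0)`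
class `x`, entry `(1,1)` class `y`); transposition terms `(i, j)` (entry `(1,0)` class `i ≤ K−3`, entry `(0,1)` class `j ≥ 2`) along the path
`(0,2),(0,3),…,(0,K−1),(1,K−1),…,(K−3,K−1)`; in the tower's lex order the `4K − 6` slopes read
`2d₀ < d₀+d₁ < 2d₁ < [d₀+d_j < d_{j−1}+d_j < 2d_j]_{j=2…K−2} < d₀+d_{K−1} < ⋯ < d_{K−3}+d_{K−1} < d_{K−2}+d_{K−1} < 2d_{K−1}`; every chain cost is
FREE (each step introduces a new class in one entry), so the costs are the chain's own convex interpolation (`Cg`, times `4ᵏ`) and the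
ENVELOPE CRITERION (p817916) applies.  [this seat's construction; folklore technique]
-/

set_option linter.dupNamespace false
set_option autoImplicit false

namespace Summit.ValiantsHypothesis.ValiantsHypothesis.Theorems.KPlusLogSqLaw.TowerGraft

open Summit.ValiantsHypothesis.ValiantsHypothesis.Theorems.MatrixDescartes.Negative
open Summit.ValiantsHypothesis.ValiantsHypothesis.Theorems.LacunarySymmetroidMatrixDescartes
open Summit.ValiantsHypothesis.ValiantsHypothesis.Theorems.LacunarySymmetroidMatrixDescartes.TropicalCensus
open Summit.ValiantsHypothesis.ValiantsHypothesis.Theorems.KPlusLogSqLaw.EnvelopeCriterion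
open Summit.ValiantsHypothesis.ValiantsHypothesis.Theorems.KPlusLogSqLaw.TwoRowFamily (perm_two)
open Finset

namespace TowerRowTwoGen

open TowerRowTwoSym (dN dN_lt dN_tower dN_le dN_nonneg slope_two)

/-! ## 1. Data (natural indices) -/

/-- entry-`(·,0)` class of chain term `k`. -/
def g0 (K k : ℕ) : ℕ :=
  if 3 * K ≤ k + 6 then (if k + 9 ≤ 4 * K then k + 6 - 3 * K else (if k + 8 = 4 * K then K - 2 else K - 1))
  else (if k % 3 = 0 then 0 else (if k % 3 = 1 then (k - 1) / 3 else (k + 1) / 3))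

/-- entry-`(·,1)` class of chain term `k`. -/
def g1 (K k : ℕ) : ℕ :=
  if 3 * K ≤ k + 6 then K - 1
  else (if k % 3 = 0 then (if k = 0 then 0 else k / 3 + 1) else (if k % 3 = 1 then (k + 2) / 3 else (k + 1) / 3))

/-- chain term `k` is a transposition term (early positive multiples of `3`: `(0, j)`; late column: `(i, K−1)`, `i ≤ K−3`) — as a Boolean. -/
def isSw (K k : ℕ) : Bool := if (3 * K ≤ k + 6 ∧ k + 9 ≤ 4 * K) ∨ (¬ 3 * K ≤ k + 6 ∧ k % 3 = 0 ∧ k ≠ 0) then true else false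

/-- the permutation of chain term `k`. -/
def permg (K k : ℕ) : Equiv.Perm (Fin 2) := if isSw K k = true then Equiv.swap 0 1 else 1

/-- slope of chain term `k`. -/
def Xg (K : ℕ) (d : Fin K → ℕ) (k : ℕ) : ℤ := dN K d (g0 K k) + dN K d (g1 K k)

/-- chain costs: convex interpolation with crossing times `4ᵏ`. -/
def Cg (K : ℕ) (d : Fin K → ℕ) : ℕ → ℤ
  | 0 => 0
  | k + 1 => Cg K d k + 4 ^ (k + 1) * (Xg K d (k + 1) - Xg K d k)

/-- index of the diagonal identity term `(j, j)` (`j ≥ 1`; value `0` at `j = 0` by truncation, the term `(0,0)`). -/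
def k2 (K j : ℕ) : ℕ := if j + 1 = K then 4 * K - 7 else 3 * j - 1
/-- index of the staircase identity term `(j−1, j)` (`j ≥ 1`). -/
def k1 (K j : ℕ) : ℕ := if j + 1 = K then 4 * K - 8 else 3 * j - 2

/-- valuation of class `x` in entry `(0,0)` (staircase recursion). -/
def aG (K : ℕ) (d : Fin K → ℕ) : ℕ → ℤ
  | 0 => 0
  | j + 1 => aG K d j + (Cg K d (k2 K (j + 1)) - Cg K d (k1 K (j + 1)))

/-- valuation of class `y` in entry `(1,1)`. -/
def cG (K : ℕ) (d : Fin K → ℕ) (y : ℕ) : ℤ := if y = 0 then 0 else Cg K d (k1 K y) - aG K d (y - 1)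
/-- valuation of class `i` in entry `(1,0)`. -/
def bG (K : ℕ) (d : Fin K → ℕ) (i : ℕ) : ℤ := Cg K d (3 * K - 6 + i) - Cg K d (3 * K - 6)
/-- valuation of class `j` in entry `(0,1)`. -/
def eG (K : ℕ) (d : Fin K → ℕ) (j : ℕ) : ℤ := Cg K d (3 * j - 3)

/-- the valuations (NOT symmetric: entries `(1,0)` and `(0,1)` carry different class ranges). -/
def vg (K : ℕ) (d : Fin K → ℕ) : Fin 2 → Fin 2 → Fin K → ℤ := fun i j l =>
  if i = 0 then (if j = 0 then aG K d l else eG K d l) else (if j = 0 then bG K d l else cG K d l)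

/-- the signs: `ε₀₀(x) = (−1)ˣ`; `ε₁₁(0) = 1`, `ε₁₁(y) = −1` (`1 ≤ y ≤ K−2`), `ε₁₁(K−1) = (−1)^K`; `ε₁₀(i) = (−1)ⁱ` on `i ≤ K−3`;
`ε₀₁(j) = (−1)ʲ` on `j ≥ 2`; zero elsewhere.  Chain term `k` then has sign `(−1)ᵏ`. -/
def εg (K : ℕ) : Fin 2 → Fin 2 → Fin K → ℤ := fun i j l =>
  if i = 0 then
    (if j = 0 then (-1) ^ (l : ℕ) else (if 2 ≤ (l : ℕ) then (-1) ^ (l : ℕ) else 0))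
  else
    (if j = 0 then (if (l : ℕ) + 3 ≤ K then (-1) ^ (l : ℕ) else 0)
     else (if (l : ℕ) = 0 then 1 else (if (l : ℕ) + 1 = K then (-1) ^ K else -1)))

/-- classes are letters. -/
theorem g0_lt {K : ℕ} (hK : 3 ≤ K) {k : ℕ} (_hk : k ≤ 4 * K - 7) : g0 K k < K := by
  unfold g0; split_ifs <;> omega

/-- classes are letters. -/
theorem g1_lt {K : ℕ} (hK : 3 ≤ K) {k : ℕ} (_hk : k ≤ 4 * K - 7) : g1 K k < K := by
  unfold g1; split_ifs <;> omega

/-- the chain. -/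
def termg (K : ℕ) (hK : 3 ≤ K) (k : Fin (4 * K - 7 + 1)) : Equiv.Perm (Fin 2) × (Fin 2 → Fin K) :=
  (permg K k, ![⟨g0 K k, g0_lt hK (by have := k.isLt; omega)⟩, ⟨g1 K k, g1_lt hK (by have := k.isLt; omega)⟩])

/-! ## 2. Closed forms of the classes -/

section classes
variable {K : ℕ} (hK : 3 ≤ K)
include hK

/-- the term `(0,0)`. -/
theorem cls_zero : g0 K 0 = 0 ∧ g1 K 0 = 0 ∧ isSw K 0 = false := by
  unfold g0 g1 isSw; refine ⟨?_, ?_, ?_⟩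
  · rw [if_neg (by omega), if_pos (by omega)]
  · rw [if_neg (by omega), if_pos (by omega), if_pos rfl]
  · rw [if_neg (by omega)]

omit hK in
/-- early transposition term `(0, j)`, index `3j − 3`, `2 ≤ j ≤ K − 2`. -/
theorem cls_sw_early {j : ℕ} (hj : 2 ≤ j) (hjK : j + 2 ≤ K) :
    g0 K (3 * j - 3) = 0 ∧ g1 K (3 * j - 3) = j ∧ isSw K (3 * j - 3) = true := by
  unfold g0 g1 isSw; refine ⟨?_, ?_, ?_⟩
  · rw [if_neg (by omega), if_pos (by omega)]
  · rw [if_neg (by omega), if_pos (by omega), if_neg (by omega)]; omega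
  · rw [if_pos (by omega)]

omit hK in
/-- staircase identity term `(j−1, j)`, index `3j − 2`, `1 ≤ j ≤ K − 2`. -/
theorem cls_id1 {j : ℕ} (hj : 1 ≤ j) (hjK : j + 2 ≤ K) :
    g0 K (3 * j - 2) = j - 1 ∧ g1 K (3 * j - 2) = j ∧ isSw K (3 * j - 2) = false := by
  unfold g0 g1 isSw; refine ⟨?_, ?_, ?_⟩
  · rw [if_neg (by omega), if_neg (by omega), if_pos (by omega)]; omega
  · rw [if_neg (by omega), if_neg (by omega), if_pos (by omega)]; omega
  · rw [if_neg (by omega)]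

omit hK in
/-- diagonal identity term `(j, j)`, index `3j − 1`, `1 ≤ j ≤ K − 2`. -/
theorem cls_id2 {j : ℕ} (hj : 1 ≤ j) (hjK : j + 2 ≤ K) :
    g0 K (3 * j - 1) = j ∧ g1 K (3 * j - 1) = j ∧ isSw K (3 * j - 1) = false := by
  unfold g0 g1 isSw; refine ⟨?_, ?_, ?_⟩
  · rw [if_neg (by omega), if_neg (by omega), if_neg (by omega)]; omega
  · rw [if_neg (by omega), if_neg (by omega), if_neg (by omega)]; omega
  · rw [if_neg (by omega)]

/-- late transposition term `(i, K−1)`, index `3K − 6 + i`, `i ≤ K − 3`. -/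
theorem cls_sw_late {i : ℕ} (hi : i + 3 ≤ K) :
    g0 K (3 * K - 6 + i) = i ∧ g1 K (3 * K - 6 + i) = K - 1 ∧ isSw K (3 * K - 6 + i) = true := by
  unfold g0 g1 isSw; refine ⟨?_, ?_, ?_⟩
  · rw [if_pos (by omega), if_pos (by omega)]; omega
  · rw [if_pos (by omega)]
  · rw [if_pos (by omega)]

/-- the term `(K−2, K−1)`, index `4K − 8`. -/
theorem cls_late1 : g0 K (4 * K - 8) = K - 2 ∧ g1 K (4 * K - 8) = K - 1 ∧ isSw K (4 * K - 8) = false := by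
  unfold g0 g1 isSw; refine ⟨?_, ?_, ?_⟩
  · rw [if_pos (by omega), if_neg (by omega), if_pos (by omega)]
  · rw [if_pos (by omega)]
  · rw [if_neg (by omega)]

/-- the term `(K−1, K−1)`, index `4K − 7`. -/
theorem cls_late2 : g0 K (4 * K - 7) = K - 1 ∧ g1 K (4 * K - 7) = K - 1 ∧ isSw K (4 * K - 7) = false := by
  unfold g0 g1 isSw; refine ⟨?_, ?_, ?_⟩
  · rw [if_pos (by omega), if_neg (by omega), if_neg (by omega)]
  · rw [if_pos (by omega)]
  · rw [if_neg (by omega)]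

/-- **trichotomy of chain indices**: every `k ≤ 4K − 7` is one of the seven shapes. -/
theorem index_cases (k : ℕ) (hk : k ≤ 4 * K - 7) :
    k = 0 ∨ (∃ j, 2 ≤ j ∧ j + 2 ≤ K ∧ k = 3 * j - 3) ∨ (∃ j, 1 ≤ j ∧ j + 2 ≤ K ∧ k = 3 * j - 2) ∨
      (∃ j, 1 ≤ j ∧ j + 2 ≤ K ∧ k = 3 * j - 1) ∨ (∃ i, i + 3 ≤ K ∧ k = 3 * K - 6 + i) ∨ k = 4 * K - 8 ∨ k = 4 * K - 7 := by
  by_cases hl : 3 * K ≤ k + 6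
  · by_cases h9 : k + 9 ≤ 4 * K
    · exact Or.inr (Or.inr (Or.inr (Or.inr (Or.inl ⟨k + 6 - 3 * K, by omega, by omega⟩))))
    · by_cases h8 : k + 8 = 4 * K
      · exact Or.inr (Or.inr (Or.inr (Or.inr (Or.inr (Or.inl (by omega))))))
      · exact Or.inr (Or.inr (Or.inr (Or.inr (Or.inr (Or.inr (by omega))))))
  · rcases Nat.lt_or_ge 0 k with hpos | h0
    · have h3 : k % 3 = 0 ∨ k % 3 = 1 ∨ k % 3 = 2 := by omega
      rcases h3 with h | h | h
      · exact Or.inr (Or.inl ⟨k / 3 + 1, by omega, by omega, by omega⟩)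
      · exact Or.inr (Or.inr (Or.inl ⟨(k + 2) / 3, by omega, by omega, by omega⟩))
      · exact Or.inr (Or.inr (Or.inr (Or.inl ⟨(k + 1) / 3, by omega, by omega, by omega⟩)))
    · exact Or.inl (by omega)

end classes

/-! ## 3. Slopes: closed forms and strict monotonicity (tower) -/

section tower
variable {K : ℕ} {d : Fin K → ℕ} (hd : ∀ l l' : Fin K, l < l' → 2 * d l < d l')
include hd

omit hd in
/-- the cost recursion. -/
theorem Cg_succ (k : ℕ) : Cg K d (k + 1) = Cg K d k + 4 ^ (k + 1) * (Xg K d (k + 1) - Xg K d k) := rfl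

omit hd in
/-- `Cg 0 = 0`. -/
theorem Cg_zero : Cg K d 0 = 0 := rfl

omit hd in
/-- slope of a term with known classes. -/
theorem Xg_of {k a b : ℕ} (h : g0 K k = a ∧ g1 K k = b) : Xg K d k = dN K d a + dN K d b := by
  unfold Xg; rw [h.1, h.2]

/-- **the chain slopes are strictly increasing** (tower inequality `2d_j < d₀ + d_{j+1}` at the block boundaries). -/
theorem Xg_lt_succ (hK : 3 ≤ K) {k : ℕ} (hk : k + 1 ≤ 4 * K - 7) : Xg K d k < Xg K d (k + 1) := by
  have h0 := dN_nonneg (K := K) (d := d) 0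
  rcases index_cases hK k (by omega) with rfl | ⟨j, hj, hjK, rfl⟩ | ⟨j, hj, hjK, rfl⟩ | ⟨j, hj, hjK, rfl⟩ |
      ⟨i, hi, rfl⟩ | rfl | rfl
  · -- 0 → 1 = (0,1)
    rw [Xg_of ⟨(cls_zero hK).1, (cls_zero hK).2.1⟩, show (0 : ℕ) + 1 = 3 * 1 - 2 by norm_num,
      Xg_of ⟨(cls_id1 (K := K) le_rfl (by omega)).1, (cls_id1 (K := K) le_rfl (by omega)).2.1⟩]
    have := dN_lt hd (show 0 < 1 by omega) (by omega); simp only [Nat.sub_self]; linarith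
  · -- sw(0,j) → id(j−1,j)
    rw [Xg_of ⟨(cls_sw_early (K := K) hj hjK).1, (cls_sw_early (K := K) hj hjK).2.1⟩, show 3 * j - 3 + 1 = 3 * j - 2 by omega,
      Xg_of ⟨(cls_id1 (K := K) (by omega) hjK).1, (cls_id1 (K := K) (by omega) hjK).2.1⟩]
    have := dN_lt hd (show 0 < j - 1 by omega) (by omega); linarith
  · -- id(j−1,j) → id(j,j)
    rw [Xg_of ⟨(cls_id1 (K := K) hj hjK).1, (cls_id1 (K := K) hj hjK).2.1⟩, show 3 * j - 2 + 1 = 3 * j - 1 by omega,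
      Xg_of ⟨(cls_id2 (K := K) hj hjK).1, (cls_id2 (K := K) hj hjK).2.1⟩]
    have := dN_lt hd (show j - 1 < j by omega) (by omega); linarith
  · -- id(j,j) → sw(0,j+1) (early) or → sw(0,K−1) (boundary, j = K−2)
    rw [Xg_of ⟨(cls_id2 (K := K) hj hjK).1, (cls_id2 (K := K) hj hjK).2.1⟩]
    by_cases hb : j + 2 = K
    · rw [show 3 * j - 1 + 1 = 3 * K - 6 + 0 by omega, Xg_of ⟨(cls_sw_late hK (by omega)).1, (cls_sw_late hK (by omega)).2.1⟩]
      have := dN_tower hd (show j < K - 1 by omega) (by omega); linarith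
    · rw [show 3 * j - 1 + 1 = 3 * (j + 1) - 3 by omega,
        Xg_of ⟨(cls_sw_early (K := K) (by omega) (by omega)).1, (cls_sw_early (K := K) (by omega) (by omega)).2.1⟩]
      have := dN_tower hd (show j < j + 1 by omega) (by omega); linarith
  · -- late column
    rw [Xg_of ⟨(cls_sw_late hK hi).1, (cls_sw_late hK hi).2.1⟩]
    by_cases hb : i + 3 = K
    · rw [show 3 * K - 6 + i + 1 = 4 * K - 8 by omega, Xg_of ⟨(cls_late1 hK).1, (cls_late1 hK).2.1⟩]
      have := dN_lt hd (show i < K - 2 by omega) (by omega); linarith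
    · rw [show 3 * K - 6 + i + 1 = 3 * K - 6 + (i + 1) by omega,
        Xg_of ⟨(cls_sw_late hK (by omega)).1, (cls_sw_late hK (by omega)).2.1⟩]
      have := dN_lt hd (show i < i + 1 by omega) (by omega); linarith
  · rw [show 4 * K - 8 + 1 = 4 * K - 7 by omega, Xg_of ⟨(cls_late1 hK).1, (cls_late1 hK).2.1⟩,
      Xg_of ⟨(cls_late2 hK).1, (cls_late2 hK).2.1⟩]
    have := dN_lt hd (show K - 2 < K - 1 by omega) (by omega); linarith
  · omega

/-- monotone steps. -/
theorem Xg_le_succ (hK : 3 ≤ K) : ∀ i, i + 1 ≤ 4 * K - 7 → Xg K d i ≤ Xg K d (i + 1) :=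
  fun _ hi => (Xg_lt_succ hd hK hi).le

omit hd in
/-- the crossing times increase. -/
theorem four_pow_le_succ' : ∀ i : ℕ, i + 1 ≤ 4 * K - 7 → (4 : ℤ) ^ i ≤ 4 ^ (i + 1) :=
  fun i _ => pow_le_pow_right₀ (by norm_num) (by omega)

/-- telescoped upper bound. -/
theorem Cg_sub_le (hK : 3 ≤ K) {j k : ℕ} (hjk : j ≤ k) (hk : k ≤ 4 * K - 7) :
    Cg K d k - Cg K d j ≤ 4 ^ k * (Xg K d k - Xg K d j) :=
  cost_sub_le (Xg K d) (Cg K d) (fun i => 4 ^ i) (4 * K - 7) (Xg_le_succ hd hK) four_pow_le_succ' (fun i _ => Cg_succ i) j k hjk hk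

/-- telescoped lower bound. -/
theorem le_Cg_sub (hK : 3 ≤ K) {j k : ℕ} (hjk : j ≤ k) (hk : k ≤ 4 * K - 7) :
    4 ^ (j + 1) * (Xg K d k - Xg K d j) ≤ Cg K d k - Cg K d j :=
  le_cost_sub (Xg K d) (Cg K d) (fun i => 4 ^ i) (4 * K - 7) (Xg_le_succ hd hK) four_pow_le_succ' (fun i _ => Cg_succ i) j k hjk hk

/-- monotone slopes. -/
theorem Xg_mono (hK : 3 ≤ K) {j k : ℕ} (hjk : j ≤ k) (hk : k ≤ 4 * K - 7) : Xg K d j ≤ Xg K d k :=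
  mono_of_succ (Xg K d) (4 * K - 7) (Xg_le_succ hd hK) j k hjk hk

/-! ## 4. The staircase valuation `aG`: steps and bounds -/

omit hd in
/-- the staircase step: `aG j − aG (j−1) = Cg (k2 j) − Cg (k1 j)`. -/
theorem aG_succ (j : ℕ) : aG K d (j + 1) = aG K d j + (Cg K d (k2 K (j + 1)) - Cg K d (k1 K (j + 1))) := rfl

omit hd in
/-- the step in closed form: `Cg (k2 j) − Cg (k1 j) = 4^{k2 j}·(d_j − d_{j−1})`, `1 ≤ j ≤ K − 1`. -/
theorem step_eq (hK : 3 ≤ K) {j : ℕ} (hj : 1 ≤ j) (hjK : j + 1 ≤ K) :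
    Cg K d (k2 K j) - Cg K d (k1 K j) = 4 ^ (k2 K j) * (dN K d j - dN K d (j - 1)) := by
  by_cases hb : j + 1 = K
  · have e2 : k2 K j = 4 * K - 7 := by unfold k2; rw [if_pos hb]
    have e1 : k1 K j = 4 * K - 8 := by unfold k1; rw [if_pos hb]
    rw [e2, e1, show 4 * K - 7 = 4 * K - 8 + 1 by omega, Cg_succ, show 4 * K - 8 + 1 = 4 * K - 7 by omega,
      Xg_of ⟨(cls_late2 hK).1, (cls_late2 hK).2.1⟩, Xg_of ⟨(cls_late1 hK).1, (cls_late1 hK).2.1⟩,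
      show j = K - 1 by omega, show K - 1 - 1 = K - 2 by omega]
    ring
  · have e2 : k2 K j = 3 * j - 1 := by unfold k2; rw [if_neg hb]
    have e1 : k1 K j = 3 * j - 2 := by unfold k1; rw [if_neg hb]
    rw [e2, e1, show 3 * j - 1 = 3 * j - 2 + 1 by omega, Cg_succ, show 3 * j - 2 + 1 = 3 * j - 1 by omega,
      Xg_of ⟨(cls_id2 (K := K) hj (by omega)).1, (cls_id2 (K := K) hj (by omega)).2.1⟩,
      Xg_of ⟨(cls_id1 (K := K) hj (by omega)).1, (cls_id1 (K := K) hj (by omega)).2.1⟩]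
    ring

/-- the staircase valuation is monotone. -/
theorem aG_mono (hK : 3 ≤ K) : ∀ {y x : ℕ}, y ≤ x → x + 1 ≤ K → aG K d y ≤ aG K d x := by
  intro y x hyx hxK
  induction x with
  | zero =>
    have : y = 0 := by omega
    subst this; exact le_rfl
  | succ x ih =>
    rcases Nat.eq_or_lt_of_le hyx with rfl | hlt
    · exact le_rfl
    · have h1 := ih (by omega) (by omega)
      rw [aG_succ, step_eq hK (by omega) hxK, show x + 1 - 1 = x by omega]
      have := dN_lt hd (show x < x + 1 by omega) (by omega)
      have : (0 : ℤ) ≤ 4 ^ k2 K (x + 1) * (dN K d (x + 1) - dN K d x) := by positivity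
      linarith

/-- lower bound by the top step: `4^{k2 x}(d_x − d_{x−1}) ≤ aG x − aG y` for `y < x ≤ K − 1`. -/
theorem aG_sub_ge (hK : 3 ≤ K) {y x : ℕ} (hyx : y < x) (hxK : x + 1 ≤ K) :
    4 ^ (k2 K x) * (dN K d x - dN K d (x - 1)) ≤ aG K d x - aG K d y := by
  obtain ⟨x', rfl⟩ : ∃ x', x = x' + 1 := ⟨x - 1, by omega⟩
  rw [aG_succ, step_eq hK (by omega) hxK]
  have := aG_mono hd hK (show y ≤ x' by omega) (by omega)
  linarith

/-- upper bound for early classes: `aG x − aG y ≤ 4^{3x−1}(d_x − d_y)` for `y ≤ x ≤ K − 2`. -/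
theorem aG_sub_le (hK : 3 ≤ K) : ∀ {y x : ℕ}, y ≤ x → x + 2 ≤ K → aG K d x - aG K d y ≤ 4 ^ (3 * x - 1) * (dN K d x - dN K d y) := by
  intro y x hyx hxK
  induction x with
  | zero =>
    have : y = 0 := by omega
    subst this; simp
  | succ x ih =>
    rcases Nat.eq_or_lt_of_le hyx with rfl | hlt
    · simp
    · have h1 := ih (by omega) (by omega)
      have e2 : k2 K (x + 1) = 3 * (x + 1) - 1 := by unfold k2; rw [if_neg (by omega)]
      rw [aG_succ, step_eq hK (by omega) (by omega), e2, show x + 1 - 1 = x by omega]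
      have hpow : (4 : ℤ) ^ (3 * x - 1) ≤ 4 ^ (3 * (x + 1) - 1) := pow_le_pow_right₀ (by norm_num) (by omega)
      have hxy : 0 ≤ dN K d x - dN K d y := by have := dN_le hd (show y ≤ x by omega) (by omega); linarith
      nlinarith [mul_le_mul_of_nonneg_right hpow hxy]

end tower

variable {K : ℕ}

/-! ## 6. Closed forms of the chain slopes -/

section slopes
variable (hK : 3 ≤ K) (d : Fin K → ℕ)
include hK

/-- `Xg 0 = 2d₀`. -/
theorem X0 : Xg K d 0 = dN K d 0 + dN K d 0 := Xg_of ⟨(cls_zero hK).1, (cls_zero hK).2.1⟩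
omit hK in
/-- `Xg (3j−3) = d₀ + d_j`. -/
theorem Xsw {j : ℕ} (hj : 2 ≤ j) (hjK : j + 2 ≤ K) : Xg K d (3 * j - 3) = dN K d 0 + dN K d j :=
  Xg_of ⟨(cls_sw_early (K := K) hj hjK).1, (cls_sw_early (K := K) hj hjK).2.1⟩
omit hK in
/-- `Xg (3j−2) = d_{j−1} + d_j`. -/
theorem Xid1 {j : ℕ} (hj : 1 ≤ j) (hjK : j + 2 ≤ K) : Xg K d (3 * j - 2) = dN K d (j - 1) + dN K d j :=
  Xg_of ⟨(cls_id1 (K := K) hj hjK).1, (cls_id1 (K := K) hj hjK).2.1⟩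
omit hK in
/-- `Xg (3j−1) = 2 d_j`. -/
theorem Xid2 {j : ℕ} (hj : 1 ≤ j) (hjK : j + 2 ≤ K) : Xg K d (3 * j - 1) = dN K d j + dN K d j :=
  Xg_of ⟨(cls_id2 (K := K) hj hjK).1, (cls_id2 (K := K) hj hjK).2.1⟩
/-- `Xg (3K−6+i) = d_i + d_{K−1}`. -/
theorem Xlate {i : ℕ} (hi : i + 3 ≤ K) : Xg K d (3 * K - 6 + i) = dN K d i + dN K d (K - 1) :=
  Xg_of ⟨(cls_sw_late hK hi).1, (cls_sw_late hK hi).2.1⟩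
/-- `Xg (4K−8) = d_{K−2} + d_{K−1}`. -/
theorem Xl1 : Xg K d (4 * K - 8) = dN K d (K - 2) + dN K d (K - 1) := Xg_of ⟨(cls_late1 hK).1, (cls_late1 hK).2.1⟩

end slopes
end TowerRowTwoGen

end Summit.ValiantsHypothesis.ValiantsHypothesis.Theorems.KPlusLogSqLaw.TowerGraft
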